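import Mathlib
import Literature.NumberTheory.Sieve.Maynard2016ClassCRT
import HarnessLib

/-!
# Maynard 2016: the local divisibility system `d ∣ n + c`, `e ∣ m(n + c) − 1` has one solution mod `de`

Topic `Literature/NumberTheory/Sieve`. J. Maynard, *Large gaps between primes*, Ann. of Math. (2)
183 (2016), 915–933 = arXiv:1408.5110, §4 display (4.1) and §6 displays (6.7)–(6.8),
(6.24)–(6.25): in the expansion of `α_{m,q}^{-1}` the conditions `d_j ∣ n + h_j q` and
`e_j ∣ m(n + h_j q) − 1` (with `(d_j, e_j) = 1`, `(m, e_j) = 1`) determine `n` uniquely modulo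
`d_j e_j` "by the Chinese remainder theorem"; combined with `Maynard2016ClassCRT` this gives the
count `N/(P_w ∏ d_j e_j) + O(1)` of such `n ≤ N` in a class modulo `P_w`.

PROVED here (no named facts): `card_filter_range_dvd_add` (`a ∣ n + c` has one solution mod `a`),
`card_filter_range_dvd_mul_add_sub_one` (`b ∣ m(n + c) − 1` has one solution mod `b` when
`(m, b) = 1`, `c ≥ 1`), the periods (`periodic_dvd_add`, `periodic_dvd_mul_add_sub_one`) and
`card_filter_range_local_system` (one solution mod `ab` for coprime `a, b`).

## References

* J. Maynard, *Large gaps between primes*, Ann. of Math. (2) 183 (2016), 915–933; arXiv:1408.5110,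
  §4 (4.1), §6 (6.7)–(6.8), (6.24)–(6.25). [Maynard2016LargeGaps]
-/

open Filter Finset
open scoped Topology

namespace Literature.NumberTheory.Sieve

namespace Maynard2016

/-- `a ∣ n + c` has exactly one solution `0 ≤ n < a` (`a ≥ 1`). [cite: Maynard2016LargeGaps, §6 display (6.8)] -/
theorem card_filter_range_dvd_add {a : ℕ} (ha : 0 < a) (c : ℕ) :
    ((Finset.range a).filter (fun n => a ∣ n + c)).card = 1 := by
  refine le_antisymm ?_ ?_
  · refine Finset.card_le_one.2 fun n₁ h₁ n₂ h₂ => ?_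
    rw [Finset.mem_filter, Finset.mem_range] at h₁ h₂
    have e1 : n₁ + c ≡ 0 [MOD a] := Nat.modEq_zero_iff_dvd.2 h₁.2
    have e2 : n₂ + c ≡ 0 [MOD a] := Nat.modEq_zero_iff_dvd.2 h₂.2
    exact Nat.ModEq.eq_of_lt_of_lt (Nat.ModEq.add_right_cancel' c (e1.trans e2.symm)) h₁.1 h₂.1
  · refine Finset.card_pos.2 ⟨(a - c % a) % a, Finset.mem_filter.2 ⟨Finset.mem_range.2 (Nat.mod_lt _ ha), ?_⟩⟩
    apply Nat.dvd_of_mod_eq_zero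
    have hca : c % a ≤ a := (Nat.mod_lt c ha).le
    have hcc : c % a ≤ c := Nat.mod_le c a
    rw [Nat.mod_add_mod, show a - c % a + c = a + (c - c % a) by omega, Nat.add_mod_left]
    exact Nat.mod_eq_zero_of_dvd (Nat.dvd_sub_mod c)

/-- `b ∣ m(n + c) − 1` has exactly one solution `0 ≤ n < b` when `(m, b) = 1` and `c ≥ 1`. [cite: Maynard2016LargeGaps, §6 display (6.8)] -/
theorem card_filter_range_dvd_mul_add_sub_one {b m c : ℕ} (hb : 0 < b) (hmb : m.Coprime b)
    (hc : 1 ≤ c) :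
    ((Finset.range b).filter (fun n => b ∣ m * (n + c) - 1)).card = 1 := by
  rcases (Nat.succ_le_of_lt hb).eq_or_lt with hb1 | hb1
  · -- `b = 1`
    subst hb1
    have : (Finset.range 1).filter (fun n => 1 ∣ m * (n + c) - 1) = Finset.range 1 :=
      Finset.filter_true_of_mem fun n _ => one_dvd _
    rw [this, Finset.card_range]
  · -- `b > 1`, so `m ≥ 1`
    have hm : 1 ≤ m := by
      rcases Nat.eq_zero_or_pos m with rfl | h
      · rw [Nat.coprime_zero_left] at hmb; omega
      · exact h
    have hmod : ∀ n, b ∣ m * (n + c) - 1 ↔ m * (n + c) ≡ 1 [MOD b] := by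
      intro n
      have h1 : 1 ≤ m * (n + c) := by
        have := Nat.mul_le_mul hm (le_add_left hc : 1 ≤ n + c); simpa using this
      rw [← Nat.modEq_iff_dvd' h1]
      exact ⟨fun h => h.symm, fun h => h.symm⟩
    refine le_antisymm ?_ ?_
    · refine Finset.card_le_one.2 fun n₁ h₁ n₂ h₂ => ?_
      rw [Finset.mem_filter, Finset.mem_range, hmod] at h₁ h₂
      have h := Nat.ModEq.cancel_left_of_coprime (c := m) hmb.symm (h₁.2.trans h₂.2.symm)
      exact Nat.ModEq.eq_of_lt_of_lt (Nat.ModEq.add_right_cancel' c h) h₁.1 h₂.1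
    · obtain ⟨u, hub, hu⟩ := Nat.exists_mul_mod_eq_one_of_coprime hmb hb1
      refine Finset.card_pos.2 ⟨(u + (b - c % b)) % b,
        Finset.mem_filter.2 ⟨Finset.mem_range.2 (Nat.mod_lt _ hb), ?_⟩⟩
      rw [hmod]
      have hcb : c % b ≤ b := (Nat.mod_lt c hb).le
      have hcc : c % b ≤ c := Nat.mod_le c b
      have e1 : (u + (b - c % b)) % b + c ≡ u + (b - c % b) + c [MOD b] :=
        (Nat.mod_modEq _ b).add_right c
      have e2 : u + (b - c % b) + c = u + (b + (c - c % b)) := by omega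
      have e3 : u + (b + (c - c % b)) ≡ u + 0 [MOD b] :=
        (Nat.ModEq.refl u).add (Nat.modEq_zero_iff_dvd.2 (dvd_add dvd_rfl (Nat.dvd_sub_mod c)))
      rw [e2] at e1
      rw [add_zero] at e3
      have e4 : m * ((u + (b - c % b)) % b + c) ≡ m * u [MOD b] := (e1.trans e3).mul_left m
      refine e4.trans ?_
      show m * u % b = 1 % b
      rw [hu, Nat.mod_eq_of_lt hb1]

/-- `a ∣ n + c` is `a`-periodic in `n`. [cite: Maynard2016LargeGaps, §6 display (6.8)] -/
theorem periodic_dvd_add (a c : ℕ) : Function.Periodic (fun n => a ∣ n + c) a := by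
  intro n
  show (a ∣ n + a + c) = (a ∣ n + c)
  rw [show n + a + c = a + (n + c) by ring, Nat.dvd_add_right (dvd_refl a)]

/-- `b ∣ m(n + c) − 1` is `b`-periodic in `n` (`c ≥ 1`). [cite: Maynard2016LargeGaps, §6 display (6.8)] -/
theorem periodic_dvd_mul_add_sub_one (b m : ℕ) {c : ℕ} (hc : 1 ≤ c) :
    Function.Periodic (fun n => b ∣ m * (n + c) - 1) b := by
  intro n
  show (b ∣ m * (n + b + c) - 1) = (b ∣ m * (n + c) - 1)
  rcases Nat.eq_zero_or_pos m with rfl | hm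
  · simp
  · have hX : 1 ≤ m * (n + c) := by
      have := Nat.mul_le_mul hm (le_add_left hc : 1 ≤ n + c); simpa using this
    have e : m * (n + b + c) - 1 = m * b + (m * (n + c) - 1) := by
      have : m * (n + b + c) = m * (n + c) + m * b := by ring
      omega
    rw [e, Nat.dvd_add_right (dvd_mul_left b m)]

/-- **One solution modulo `ab`.** For coprime `a, b ≥ 1`, `(m, b) = 1` and `c ≥ 1`:
`#{0 ≤ n < ab : a ∣ n + c ∧ b ∣ m(n + c) − 1} = 1`. [cite: Maynard2016LargeGaps, §6 displays (6.7)–(6.8) («by the Chinese remainder theorem»)] -/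
theorem card_filter_range_local_system {a b m c : ℕ} (ha : 0 < a) (hb : 0 < b)
    (hab : a.Coprime b) (hmb : m.Coprime b) (hc : 1 ≤ c) :
    ((Finset.range (a * b)).filter (fun n => a ∣ n + c ∧ b ∣ m * (n + c) - 1)).card = 1 := by
  classical
  rw [card_filter_range_mul_of_coprime ha hb hab (fun n => a ∣ n + c)
      (fun n => b ∣ m * (n + c) - 1) (periodic_dvd_add a c) (periodic_dvd_mul_add_sub_one b m hc),
    card_filter_range_dvd_add ha c, card_filter_range_dvd_mul_add_sub_one hb hmb hc]

end Maynard2016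

end Literature.NumberTheory.Sieve
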